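import Literature.Probability.RandomPlanarGeometry.SAWCountMonotoneShort
import HarnessLib

/-!
# Monotonicity `cₙ ≤ cₙ₊₁` (O'Brien 1990) up to `n = 4d`: no doubly trapped walk has `4d` steps or fewer

Sequel of `SAWCountMonotoneShort.lean` (parity: a trapped `n`-step walk has `4d ≤ n + 1`, so `cₙ ≤ cₙ₊₁`
for `n ≤ 4d - 2`) and of `SAWCountMonotoneReversal.lean` (the reversal pairing: `cₙ ≤ cₙ₊₁ + #T₂`, `T₂` =
`doublyTrapped d n` = walks with a trapped end AND at most one free site at the start).  Here the two are
combined: for `n ≤ 4d` the end of a trapped walk is adjacent to EVERY site visited at a time of the other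
parity (its `2d` neighbours exhaust the `⌊(n+1)/2⌋ ≤ 2d` available times), and then the start cannot be
nearly trapped as well:

* `eq_or_eq_of_unit_add_unit`, `eq_or_eq_of_adj_adj` : two distinct sites of `ℤ^d` have at most two
  common neighbours (`z` and `x + y - z`);
* `odd_add_of_adj_apply_apply` : sites of a self-avoiding walk that are neighbours have times of
  opposite parity;
* `card_filter_nbrs_start_le_extCount_revWalk` : the unvisited neighbours of the start are counted by
  the free extensions of the reversed walk;
* `adj_apply_of_extCount_eq_zero` : a trapped end with `n ≤ 4d` is adjacent to all sites of the other
  parity;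
* `doublyTrapped_eq_empty_of_le_four_mul` : **`T₂ = ∅` for `n ≤ 4d`, `d ≥ 2`**;
* `count_le_count_succ_of_le_four_mul` : **`cₙ ≤ cₙ₊₁` for all `n ≤ 4d` in every dimension `d ≥ 1`**
  (`d = 2`: `n ≤ 8`, where `T₂` first appears at `n = 9`; `d = 3`: `n ≤ 12`).

[cite: MadrasSlade1993, §1.1, §1.2 (p. 10), §7.1] [cite: BDGS2012, §1.3 (`cₙ ≤ cₙ₊₁`, O'Brien 1990)]
-/

noncomputable section

open Literature.Probability.LatticeModels Literature.Probability.Percolation SimpleGraph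
open scoped BigOperators

namespace Literature.Probability.RandomPlanarGeometry.SAW.Zd

variable {d : ℕ}

/-! ### Common neighbours in `ℤ^d` -/

/-- A neighbour of `0` is `σ e_i` with `σ = ± 1` (private restatement of
`SAW.Zd.Pivot.exists_single_of_adj_zero'` of `SAWPivotErgodicVariants.lean`, to keep the pivot files out of
the import closure). [cite: MadrasSlade1993, §1.1] -/
private theorem exists_eq_single_of_adj_zero {a : Site d} (h : (zdGraph d).Adj 0 a) :
    ∃ (i : Fin d) (σ : ℤ), (σ = 1 ∨ σ = -1) ∧ a = Pi.single i σ := by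
  obtain ⟨i, hi | hi⟩ := (zdGraph_adj_iff 0 a).1 h
  · exact ⟨i, 1, Or.inl rfl, by rw [hi, zero_add]⟩
  · refine ⟨i, -1, Or.inr rfl, ?_⟩
    rw [Pi.single_neg]; exact eq_neg_of_add_eq_zero_left hi.symm

/-- **Two sums of two unit steps.** If `a + b = a' + b'` for lattice unit vectors with `a + b ≠ 0`,
then `a' = a` or `a' = b`. [cite: MadrasSlade1993, §1.1] -/
theorem eq_or_eq_of_unit_add_unit {a b a' b' : Site d} (ha : (zdGraph d).Adj 0 a) (hb : (zdGraph d).Adj 0 b)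
    (ha' : (zdGraph d).Adj 0 a') (hb' : (zdGraph d).Adj 0 b') (hsum : a + b = a' + b') (hne : a + b ≠ 0) :
    a' = a ∨ a' = b := by
  obtain ⟨i, σ, hσ, rfl⟩ := exists_eq_single_of_adj_zero ha
  obtain ⟨j, τ, hτ, rfl⟩ := exists_eq_single_of_adj_zero hb
  obtain ⟨k, σ', hσ', rfl⟩ := exists_eq_single_of_adj_zero ha'
  obtain ⟨l, τ', hτ', rfl⟩ := exists_eq_single_of_adj_zero hb'
  have hk := congrFun hsum k
  have hl := congrFun hsum l
  simp only [Pi.add_apply, Pi.single_apply, if_true] at hk hl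
  by_cases hkl : l = k
  · subst hkl
    rw [if_pos rfl] at hk
    -- `a' + b' = (σ' + τ') e_l ≠ 0` forces `σ' = τ'`, then both summands on the left are `σ' e_l`
    have hst : σ' + τ' ≠ 0 := by
      intro h0
      apply hne
      rw [hsum, ← Pi.single_add, h0, Pi.single_zero]
    by_cases hki : l = i
    · subst hki
      rw [if_pos rfl] at hk
      by_cases hkj : l = j
      · subst hkj
        rw [if_pos rfl] at hk
        left; congr 1; omega
      · rw [if_neg hkj] at hk; omega
    · rw [if_neg hki] at hk
      by_cases hkj : l = j
      · subst hkj; rw [if_pos rfl] at hk; omega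
      · rw [if_neg hkj] at hk; omega
  · rw [if_neg (Ne.symm hkl), add_zero] at hk
    rw [if_neg hkl, zero_add] at hl
    by_cases hki : k = i
    · subst hki
      by_cases hkj : k = j
      · subst hkj
        -- then `a + b` is supported on `{k}`, contradicting `b' l = τ' ≠ 0`
        rw [if_neg hkl, if_neg hkl] at hl; omega
      · rw [if_pos rfl, if_neg hkj, add_zero] at hk
        left; rw [hk]
    · rw [if_neg hki, zero_add] at hk
      by_cases hkj : k = j
      · subst hkj
        rw [if_pos rfl] at hk
        right; rw [hk]
      · rw [if_neg hkj] at hk; omega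

/-- **Common neighbours in `ℤ^d`.** Two distinct sites `x ≠ y` with a common neighbour `z` have at most
one other common neighbour, namely `x + y - z`. [cite: MadrasSlade1993, §1.1] -/
theorem eq_or_eq_of_adj_adj {x y z z' : Site d} (hxy : x ≠ y) (hxz : (zdGraph d).Adj x z)
    (hzy : (zdGraph d).Adj z y) (hxz' : (zdGraph d).Adj x z') (hz'y : (zdGraph d).Adj z' y) :
    z' = z ∨ z' = x + y - z := by
  -- translate `x` to `0`: unit vectors `a = z - x`, `b = y - z`, `a' = z' - x`, `b' = y - z'`
  have ha : (zdGraph d).Adj 0 (z - x) := by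
    have := (zdGraph_adj_sub_right x z x).2 hxz; rwa [sub_self] at this
  have hb : (zdGraph d).Adj 0 (y - z) := by
    have := (zdGraph_adj_sub_right z y z).2 hzy; rwa [sub_self] at this
  have ha' : (zdGraph d).Adj 0 (z' - x) := by
    have := (zdGraph_adj_sub_right x z' x).2 hxz'; rwa [sub_self] at this
  have hb' : (zdGraph d).Adj 0 (y - z') := by
    have := (zdGraph_adj_sub_right z' y z').2 hz'y; rwa [sub_self] at this
  have hsum : (z - x) + (y - z) = (z' - x) + (y - z') := by abel
  have hne : (z - x) + (y - z) ≠ 0 := by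
    rw [show (z - x) + (y - z) = y - x by abel]; exact sub_ne_zero.2 (Ne.symm hxy)
  rcases eq_or_eq_of_unit_add_unit ha hb ha' hb' hsum hne with h | h
  · left; exact sub_left_injective h
  · right
    have : z' = (z' - x) + x := by abel
    rw [this, h]; abel

/-! ### Parity of adjacent times -/

/-- **Sites of a self-avoiding walk that are lattice neighbours were visited at times of opposite
parity** (`ℤ^d` is bipartite). [cite: MadrasSlade1993, §1.2, p. 10] -/
theorem odd_add_of_adj_apply_apply {n i j : ℕ} {ω : ℕ → Site d} (hω : ω ∈ saws d n) (hi : i ≤ n)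
    (hj : j ≤ n) (hadj : (zdGraph d).Adj (ω i) (ω j)) : (i + j) % 2 = 1 := by
  obtain ⟨m, hm⟩ := exists_sum_apply_eq_add_two_mul hω i hi
  obtain ⟨m', hm'⟩ := exists_sum_apply_eq_add_two_mul hω j hj
  rcases sum_apply_eq_of_adj hadj with h | h <;> rw [hm, hm'] at h <;> omega

/-! ### Free sites at the start, counted through the reversed walk -/

/-- The unvisited neighbours of the start of `ω` inject into the free extensions of the reversed walk
(`z ↦ ω n - z`), so there are at most `extCount (revWalk n ω) n` of them.
[cite: MadrasSlade1993, §1.1 (reversal symmetry)] -/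
theorem card_filter_nbrs_start_le_extCount_revWalk {n : ℕ} {ω : ℕ → Site d} (hω : ω ∈ saws d n) :
    ((nbrs (ω 0)).filter fun z => ∀ i ≤ n, ω i ≠ z).card ≤ extCount (revWalk n ω) n := by
  classical
  rw [extCount]
  refine Finset.card_le_card_of_injOn (fun z => ω n - z) (fun z hz => ?_) ?_
  · rw [Finset.mem_coe, Finset.mem_filter] at hz
    show ω n - z ∈ (freeNbrs (revWalk n ω) n : Set (Site d))
    rw [Finset.mem_coe, mem_freeNbrs_revWalk hω, sub_sub_cancel]
    exact ⟨mem_nbrs.1 hz.1, hz.2⟩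
  · intro z _ z' _ h
    simpa using h

/-! ### The structure of a short trapped end -/

/-- **A trapped end of a walk with `n ≤ 4d` steps is adjacent to EVERY site of the other parity**: its
`2d` neighbours need `2d` distinct visiting times among the `⌊(n+1)/2⌋ ≤ 2d` times `i < n` with
`i + n` odd, so all of these times are used. [cite: MadrasSlade1993, §1.2, p. 10; §7.1] -/
theorem adj_apply_of_extCount_eq_zero {n : ℕ} {ω : ℕ → Site d} (hω : ω ∈ saws d n)
    (h0 : extCount ω n = 0) (hn : n ≤ 4 * d) {i : ℕ} (hi : i < n) (hpar : (i + n) % 2 = 1) :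
    (zdGraph d).Adj (ω n) (ω i) := by
  classical
  set V := (Finset.range n).filter fun i => (zdGraph d).Adj (ω n) (ω i) with hV
  set P := (Finset.range n).filter fun i => (i + n) % 2 = 1 with hP
  have hVP : V ⊆ P := by
    intro i hi
    rw [hV, Finset.mem_filter, Finset.mem_range] at hi
    rw [hP, Finset.mem_filter, Finset.mem_range]
    exact ⟨hi.1, odd_add_of_adj_apply hω hi.1.le hi.2⟩
  -- every neighbour of the endpoint is `ω i` for some `i ∈ V`
  have hsub : nbrs (ω n) ⊆ V.image ω := by
    intro y hy
    have hvis : ∃ i ≤ n, ω i = y := by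
      by_contra h
      have : y ∈ freeNbrs ω n := mem_freeNbrs.2 ⟨mem_nbrs.1 hy, fun i hi hiy => h ⟨i, hi, hiy⟩⟩
      rw [extCount, Finset.card_eq_zero] at h0
      rw [h0] at this
      exact Finset.notMem_empty y this
    obtain ⟨i, hi, rfl⟩ := hvis
    have hin : i ≠ n := fun h => (mem_nbrs.1 hy).ne (by rw [h])
    exact Finset.mem_image.2 ⟨i, by
      rw [hV, Finset.mem_filter, Finset.mem_range]; exact ⟨by omega, mem_nbrs.1 hy⟩, rfl⟩
  have hcardV : 2 * d ≤ V.card := by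
    calc 2 * d = (nbrs (ω n)).card := (card_nbrs _).symm
      _ ≤ (V.image ω).card := Finset.card_le_card hsub
      _ ≤ V.card := Finset.card_image_le
  have hcardP : P.card ≤ (n + 1) / 2 := by
    have hmaps : ∀ i ∈ P, i / 2 ∈ Finset.range ((n + 1) / 2) := by
      intro i hi
      rw [hP, Finset.mem_filter, Finset.mem_range] at hi
      rw [Finset.mem_range]; omega
    have hinj : Set.InjOn (fun i => i / 2) (P : Set ℕ) := by
      intro i hi i' hi' h
      rw [Finset.mem_coe, hP, Finset.mem_filter] at hi hi'
      simp only at h; omega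
    have := Finset.card_le_card_of_injOn (fun i => i / 2) hmaps hinj
    rwa [Finset.card_range] at this
  have hPV : P.card ≤ V.card := by omega
  have hVeq : V = P := Finset.eq_of_subset_of_card_le hVP hPV
  have : i ∈ P := by rw [hP, Finset.mem_filter, Finset.mem_range]; exact ⟨hi, hpar⟩
  rw [← hVeq, hV, Finset.mem_filter] at this
  exact this.2

/-! ### No doubly trapped walk with at most `4d` steps -/

/-- A finite set contained in a pair has at most two elements. [folklore] -/
private theorem card_le_two_of_subset_pair {α : Type*} [DecidableEq α] {s : Finset α} {a b : α}
    (h : s ⊆ {a, b}) : s.card ≤ 2 :=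
  (Finset.card_le_card h).trans ((Finset.card_insert_le a {b}).trans (by rw [Finset.card_singleton]))

/-- **No doubly trapped walk has `n ≤ 4d` steps (`d ≥ 2`).** If the end of an `n`-step self-avoiding
walk with `n ≤ 4d` is trapped, then by `adj_apply_of_extCount_eq_zero` the endpoint `e` is adjacent to
every site of the other parity; the visited neighbours of the start `0` are sites of odd time, and
* for `n` even they are common neighbours of `0` and `e ≠ 0`, of which `ℤ^d` has at most two
  (`eq_or_eq_of_adj_adj`);
* for `n` odd, `e ∼ 0`, and an odd-time site `ω j ∼ 0` with `3 ≤ j ≤ n-2` would be the second common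
  neighbour of `0` and `ω (j-1)` AND of `0` and `ω (j+1)` besides `e`, forcing `ω (j-1) = ω (j+1)`;
  so they are among `ω 1, ω n`.
Either way the start has at most two visited neighbours, hence at least `2d - 2 ≥ 2` free ones, and the
walk is not doubly trapped. [cite: MadrasSlade1993, §1.2, p. 10; §7.1] [cite: BDGS2012, §1.3] -/
theorem doublyTrapped_eq_empty_of_le_four_mul {n : ℕ} (hd : 2 ≤ d) (hn : n ≤ 4 * d) :
    doublyTrapped d n = ∅ := by
  classical
  refine Finset.eq_empty_of_forall_notMem fun ω hωT => ?_
  obtain ⟨hω, h0, h1⟩ := mem_doublyTrapped.1 hωT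
  obtain ⟨h00, hend, hadj, hinj⟩ := mem_saws.1 hω
  have hn7 : 4 * d ≤ n + 1 := four_mul_le_of_extCount_eq_zero hω h0
  have hinj' : ∀ i ≤ n, ∀ j ≤ n, ω i = ω j → i = j := fun i hi j hj h =>
    hinj (show i ∈ {i | i ≤ n} from hi) (show j ∈ {i | i ≤ n} from hj) h
  -- unvisited (`U`) and visited (`W`) neighbours of the start
  set U := (nbrs (ω 0)).filter fun z => ∀ i ≤ n, ω i ≠ z with hU
  set W := (nbrs (ω 0)).filter fun z => ¬ ∀ i ≤ n, ω i ≠ z with hW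
  have hUW : U.card + W.card = 2 * d := by
    rw [hU, hW, Finset.card_filter_add_card_filter_not, card_nbrs]
  have hU1 : U.card ≤ 1 := (card_filter_nbrs_start_le_extCount_revWalk hω).trans h1
  have hW3 : 3 ≤ W.card := by omega
  have hWmem : ∀ z ∈ W, (zdGraph d).Adj (ω 0) z ∧ ∃ j ≤ n, j % 2 = 1 ∧ ω j = z := by
    intro z hz
    rw [hW, Finset.mem_filter] at hz
    obtain ⟨hz, hvis⟩ := hz
    have hadj0 := mem_nbrs.1 hz
    have hex : ∃ i ≤ n, ω i = z := by
      by_contra h; exact hvis fun i hi hiz => h ⟨i, hi, hiz⟩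
    obtain ⟨j, hj, rfl⟩ := hex
    have hpar := odd_add_of_adj_apply_apply hω (Nat.zero_le n) hj hadj0
    exact ⟨hadj0, j, hj, by omega, rfl⟩
  have hW2 : W.card ≤ 2 := by
    rcases Nat.even_or_odd n with ⟨m, hm⟩ | ⟨m, hm⟩
    · -- `n` even: visited start-neighbours are common neighbours of `ω 0` and `ω n`
      obtain ⟨z₀, hz₀⟩ := Finset.card_pos.1 (by omega : 0 < W.card)
      have key : ∀ z ∈ W, (zdGraph d).Adj (ω 0) z ∧ (zdGraph d).Adj z (ω n) := by
        intro z hz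
        obtain ⟨hadj0, j, hj, hjodd, rfl⟩ := hWmem z hz
        refine ⟨hadj0, ((adj_apply_of_extCount_eq_zero hω h0 hn (i := j) (by omega) (by omega))).symm⟩
      have h0n : ω 0 ≠ ω n := fun h => by have := hinj' 0 (Nat.zero_le n) n le_rfl h; omega
      refine card_le_two_of_subset_pair (a := z₀) (b := ω 0 + ω n - z₀) fun z hz => ?_
      obtain ⟨ha, hb⟩ := key z₀ hz₀
      obtain ⟨ha', hb'⟩ := key z hz
      rcases eq_or_eq_of_adj_adj h0n ha hb ha' hb' with h | h
      · rw [h]; exact Finset.mem_insert_self _ _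
      · rw [h]; exact Finset.mem_insert_of_mem (Finset.mem_singleton_self _)
    · -- `n` odd: `ω n ∼ ω 0`, and the visited start-neighbours are among `ω 1`, `ω n`
      have hn0 : (zdGraph d).Adj (ω n) (ω 0) :=
        adj_apply_of_extCount_eq_zero hω h0 hn (i := 0) (by omega) (by omega)
      refine card_le_two_of_subset_pair (a := ω 1) (b := ω n) fun z hz => ?_
      obtain ⟨hadj0, j, hj, hjodd, rfl⟩ := hWmem z hz
      by_cases hj1 : j = 1
      · subst hj1; exact Finset.mem_insert_self _ _
      by_cases hjn : j = n
      · subst hjn; exact Finset.mem_insert_of_mem (Finset.mem_singleton_self _)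
      exfalso
      -- `3 ≤ j ≤ n - 2`; write `j = k + 1`
      obtain ⟨k, rfl⟩ : ∃ k, j = k + 1 := ⟨j - 1, by omega⟩
      have hk2 : 2 ≤ k := by omega
      have hkn : k + 2 < n := by omega
      have hu : (zdGraph d).Adj (ω n) (ω k) :=
        adj_apply_of_extCount_eq_zero hω h0 hn (i := k) (by omega) (by omega)
      have hv : (zdGraph d).Adj (ω n) (ω (k + 2)) :=
        adj_apply_of_extCount_eq_zero hω h0 hn (i := k + 2) hkn (by omega)
      have h0u : ω 0 ≠ ω k := fun h => by have := hinj' 0 (Nat.zero_le n) k (by omega) h; omega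
      have h0v : ω 0 ≠ ω (k + 2) := fun h => by
        have := hinj' 0 (Nat.zero_le n) (k + 2) (by omega) h; omega
      have hju : (zdGraph d).Adj (ω (k + 1)) (ω k) := (hadj k (by omega)).symm
      have hjv : (zdGraph d).Adj (ω (k + 1)) (ω (k + 2)) := hadj (k + 1) (by omega)
      have hjne : ω (k + 1) ≠ ω n := fun h => hjn (hinj' (k + 1) hj n le_rfl h)
      rcases eq_or_eq_of_adj_adj h0u hn0.symm hu hadj0 hju with h | h
      · exact hjne h
      rcases eq_or_eq_of_adj_adj h0v hn0.symm hv hadj0 hjv with h' | h'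
      · exact hjne h'
      have huv : ω k = ω (k + 2) := by
        have := h.symm.trans h'
        simpa using this
      have := hinj' k (by omega) (k + 2) (by omega) huv
      omega
  omega

/-- **`cₙ ≤ cₙ₊₁` for all `n ≤ 4d`, in every dimension `d ≥ 1`**: by `count_le_count_succ_add_card_doublyTrapped`
(`cₙ ≤ cₙ₊₁ + #T₂`, the reversal pairing) and `doublyTrapped_eq_empty_of_le_four_mul` for `d ≥ 2`, and
`count_one_le_count_one_succ` for `d = 1`.  (`d = 2`: `n ≤ 8`; `d = 3`: `n ≤ 12`.)
[cite: BDGS2012, §1.3] [cite: MadrasSlade1993, §7.1] -/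
theorem count_le_count_succ_of_le_four_mul {n : ℕ} (hd : 1 ≤ d) (hn : n ≤ 4 * d) :
    count d n ≤ count d (n + 1) := by
  rcases Nat.lt_or_ge d 2 with hd1 | hd2
  · obtain rfl : d = 1 := by omega
    exact count_one_le_count_one_succ n
  · have := count_le_count_succ_add_card_doublyTrapped d n
    rw [doublyTrapped_eq_empty_of_le_four_mul hd2 hn, Finset.card_empty, add_zero] at this
    exact this

end Literature.Probability.RandomPlanarGeometry.SAW.Zd
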